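import Summits.Ventures.PercRepro.MinorC011

/-!
# PercRepro — Lemma B⁺ on SIMPLE graphs with ≤ N vertices gives it on all multigraphs with ≤ N vertices (typer-2, gen 4)

p1's `P1-census-g3.md` §A: «the class-level statement for all SIMPLE graphs on ≤ N vertices implies
it for all MULTIGRAPHS (with loops) on ≤ N vertices (induction on |E|: a parallel pair reduces to
`G − e′` and `G/e`, both smaller)». In Lean the bit-forced sums of `CubeSum.lean` are identified
with the full-cube class sums of the quotient minors (`cubeSumDel_eq_faceSum`,
`cubeSumDelCon_eq_faceSum`), a loop doubles the class sum (`cubeSum_loop`), and the induction runs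
over all marked multigraphs on `≤ N` vertices by the number of edges:

* **`LemmaBPlusSimpleUpTo N`** — the simple-graph census as a Prop;
* **`LemmaBPlusUpTo_of_simple : LemmaBPlusSimpleUpTo N → LemmaBPlusUpTo N`**, hence
  **`C011UpTo_of_simple`**, **`C005UpTo_of_simple`** — p1's «theorem on ≤ 8 vertices» rests on
  `LemmaBPlusSimpleUpTo 8` alone (the 12,346 × 70 census).
-/

namespace PercRepro

open Finset

section Reindex

variable {E : Type*} [Fintype E] [DecidableEq E] {ι : Type*}

/-- The class sum of `K ∘ c` on the class `(join u, meet v)` (generic face sum). -/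
noncomputable def faceSum (K : ι → ι → ℝ) (c : Config E → ι) (u v : Config E) : ℝ :=
  ∑ ρ : Config (Face u v), K (c (embed u v ρ)) (c (embed u v ρᶜ))

/-- `cubeSumDel K c e'` is the class sum of the class «`e'` closed, nothing sure». -/
theorem cubeSumDel_eq_faceSum (K : ι → ι → ℝ) (c : Config E → ι) (e' : E) :
    cubeSumDel K c e' = faceSum K c (fun x => decide (x ≠ e')) ⊥ := by
  unfold cubeSumDel faceSum
  rw [← Finset.sum_filter]
  symm
  refine Finset.sum_nbij' (fun ρ => embed (fun x => decide (x ≠ e')) ⊥ ρ)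
    (fun ω => restrict (fun x => decide (x ≠ e')) ⊥ ω) ?_ ?_ ?_ ?_ ?_
  · intro ρ _
    simp only [Finset.mem_filter, Finset.mem_univ, true_and]
    rw [embed_apply_of_not _ _ _ (by simp)]
    simp
  · intro ω _
    exact Finset.mem_univ _
  · intro ρ _
    exact restrict_embed _ _ ρ
  · intro ω hω
    simp only [Finset.mem_filter, Finset.mem_univ, true_and] at hω
    funext x
    by_cases hx : x = e'
    · subst hx
      rw [embed_apply_of_not _ _ _ (by simp), hω]
      simp
    · rw [embed_apply_of_mem _ _ _ ⟨by simp, by simp [hx]⟩]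
      rfl
  · intro ρ _
    congr 2
    funext x
    by_cases hx : x = e'
    · subst hx
      rw [embed_apply_of_not _ _ _ (by simp), Function.update_self]
      simp
    · rw [embed_apply_of_mem _ _ _ ⟨by simp, by simp [hx]⟩, Function.update_of_ne hx,
        compl_apply_bool, compl_apply_bool, embed_apply_of_mem _ _ _ ⟨by simp, by simp [hx]⟩]

/-- `cubeSumDelCon K c e' e` is the class sum of the class «`e'` closed, `e` sure». -/
theorem cubeSumDelCon_eq_faceSum (K : ι → ι → ℝ) (c : Config E → ι) {e' e : E} (hne : e ≠ e') :
    cubeSumDelCon K c e' e = faceSum K c (fun x => decide (x ≠ e')) (fun x => decide (x = e)) := by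
  unfold cubeSumDelCon faceSum
  rw [← Finset.sum_filter]
  symm
  refine Finset.sum_nbij' (fun ρ => embed (fun x => decide (x ≠ e')) (fun x => decide (x = e)) ρ)
    (fun ω => restrict (fun x => decide (x ≠ e')) (fun x => decide (x = e)) ω) ?_ ?_ ?_ ?_ ?_
  · intro ρ _
    simp only [Finset.mem_filter, Finset.mem_univ, true_and]
    constructor
    · rw [embed_apply_of_not _ _ _ (by simp)]
      simp [hne.symm]
    · rw [embed_apply_of_not _ _ _ (by simp)]
      simp
  · intro ω _
    exact Finset.mem_univ _
  · intro ρ _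
    exact restrict_embed _ _ ρ
  · intro ω hω
    simp only [Finset.mem_filter, Finset.mem_univ, true_and] at hω
    funext x
    by_cases hx : x = e'
    · subst hx
      rw [embed_apply_of_not _ _ _ (by simp), hω.1]
      simp [hne.symm]
    by_cases hxe : x = e
    · subst hxe
      rw [embed_apply_of_not _ _ _ (by simp), hω.2]
      simp
    · rw [embed_apply_of_mem _ _ _ ⟨by simp [hxe], by simp [hx]⟩]
      rfl
  · intro ρ _
    congr 2
    funext x
    by_cases hx : x = e'
    · subst hx
      rw [embed_apply_of_not _ _ _ (by simp), Function.update_of_ne hne.symm, Function.update_self]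
      simp [hne.symm]
    by_cases hxe : x = e
    · subst hxe
      rw [embed_apply_of_not _ _ _ (by simp), Function.update_self]
      simp
    · rw [embed_apply_of_mem _ _ _ ⟨by simp [hxe], by simp [hx]⟩, Function.update_of_ne hxe,
        Function.update_of_ne hx, compl_apply_bool, compl_apply_bool,
        embed_apply_of_mem _ _ _ ⟨by simp [hxe], by simp [hx]⟩]

/-- **A loop doubles the class sum**: for a row map blind to `e`, `CS = 2·CS(G − e)`. -/
theorem cubeSum_loop (K : ι → ι → ℝ) (c : Config E → ι) (e : E)
    (H : ∀ (ω : Config E) (b : Bool), c (Function.update ω e b) = c ω) :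
    cubeSum K c = 2 * cubeSumDel K c e := by
  unfold cubeSum cubeSumDel
  have hsplit : ∑ ρ : Config E, K (c ρ) (c ρᶜ) =
      (∑ ρ : Config E, if ρ e = false then K (c ρ) (c ρᶜ) else 0) +
        ∑ ρ : Config E, if ρ e = true then K (c ρ) (c ρᶜ) else 0 := by
    rw [← Finset.sum_add_distrib]
    refine Finset.sum_congr rfl fun ρ _ => ?_
    cases ρ e <;> simp
  have h0 : (∑ ρ : Config E, if ρ e = false then K (c ρ) (c ρᶜ) else 0) =
      ∑ ρ : Config E, if ρ e = false then K (c ρ) (c (Function.update ρᶜ e false)) else 0 := by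
    refine Finset.sum_congr rfl fun ρ _ => ?_
    split_ifs
    · rw [H ρᶜ false]
    · rfl
  have h1 : (∑ ρ : Config E, if ρ e = true then K (c ρ) (c ρᶜ) else 0) =
      ∑ ρ : Config E, if ρ e = false then K (c ρ) (c (Function.update ρᶜ e false)) else 0 := by
    refine sum_ite_bij _ _ _ _ (fun ρ => Function.update ρ e false)
      (fun ρ => Function.update ρ e true) ?_ ?_ ?_ ?_ ?_
    · intro ρ _
      exact Function.update_self _ _ _
    · intro ρ _
      exact Function.update_self _ _ _
    · intro ρ h
      rw [Function.update_idem, update_eq_self_of_eq h]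
    · intro ρ h
      rw [Function.update_idem, update_eq_self_of_eq h]
    · intro ρ h
      rw [H ρ false, compl_update, Function.update_idem,
        update_eq_self_of_eq (compl_apply_of_eq_true h)]
  rw [hsplit, h0, h1]
  ring

end Reindex

namespace MultiGraph

variable {V E : Type*} (G : MultiGraph V E) [DecidableEq E]

/-- A loop never changes connectivity. -/
theorem conn_update_iff_of_loop {e : E} (he : G.fst e = G.snd e) (ω : Config E) (b : Bool)
    (x y : V) : G.Conn (Function.update ω e b) x y ↔ G.Conn ω x y := by
  have key : ∀ (ω' : Config E) {x y : V}, G.Conn ω' x y →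
      G.Conn (Function.update ω' e false) x y := by
    intro ω' x y h
    unfold Conn at h
    induction h with
    | refl => exact Conn.refl _ _ _
    | @tail w₁ w₂ _ hadj ih =>
      refine ih.trans ?_
      obtain ⟨f, hf, hend⟩ := hadj
      by_cases hfe : f = e
      · subst hfe
        have hw : w₁ = w₂ := by
          rcases hend with ⟨h1, h2⟩ | ⟨h1, h2⟩
          · rw [← h1, ← h2, he]
          · rw [← h1, ← h2, he]
        rw [hw]
        exact Conn.refl _ _ _
      · exact Conn.of_openAdj ⟨f, by rw [Function.update_of_ne hfe]; exact hf, hend⟩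
  cases b
  · exact ⟨fun h => h.mono (update_false_le ω e), fun h => key ω h⟩
  · refine ⟨fun h => ?_, fun h => h.mono (le_update_true ω e)⟩
    have h' := key _ h
    rw [Function.update_idem] at h'
    exact h'.mono (update_false_le ω e)

/-- The row map is blind to a loop. -/
theorem row4_markedPartition_update_of_loop {e : E} (he : G.fst e = G.snd e) (m : Fin 4 → V)
    (ω : Config E) (b : Bool) :
    row4 (G.markedPartition (Function.update ω e b) m) = row4 (G.markedPartition ω m) := by
  congr 1
  ext i j
  exact G.conn_update_iff_of_loop he ω b (m i) (m j)

variable [Fintype E]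

/-- **`CS(G) = 2·CS(G − e)` for a loop `e`.** -/
theorem cubeSumC011_loop {e : E} (he : G.fst e = G.snd e) (m : Fin 4 → V) :
    G.cubeSumC011 m =
      2 * cubeSumDel phiPlusKernel (fun ρ => row4 (G.markedPartition ρ m)) e :=
  cubeSum_loop _ _ e fun ω b => G.row4_markedPartition_update_of_loop he m ω b

/-- `CS(G − e')` is the full-cube class sum of the minor «`e'` deleted». -/
theorem cubeSumDel_eq_minor (m : Fin 4 → V) (e' : E) :
    cubeSumDel phiPlusKernel (fun ρ => row4 (G.markedPartition ρ m)) e' =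
      (G.minor (fun x => decide (x ≠ e')) ⊥).cubeSumC011 fun i => G.sureClass ⊥ (m i) := by
  rw [cubeSumDel_eq_faceSum, ← G.faceSumC011_eq_minor]
  rfl

/-- `CS(G/e − e')` is the full-cube class sum of the minor «`e'` deleted, `e` contracted». -/
theorem cubeSumDelCon_eq_minor (m : Fin 4 → V) {e' e : E} (hne : e ≠ e') :
    cubeSumDelCon phiPlusKernel (fun ρ => row4 (G.markedPartition ρ m)) e' e =
      (G.minor (fun x => decide (x ≠ e')) (fun x => decide (x = e))).cubeSumC011
        fun i => G.sureClass (fun x => decide (x = e)) (m i) := by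
  rw [cubeSumDelCon_eq_faceSum _ _ hne, ← G.faceSumC011_eq_minor]
  rfl

/-- A SIMPLE multigraph: no loops, no parallel pairs. -/
def IsSimple : Prop :=
  (∀ e, G.fst e ≠ G.snd e) ∧ ∀ e e', G.Parallel e e' → e = e'

end MultiGraph

/-- **Lemma B⁺ on the full cube of every SIMPLE marked graph with at most `N` vertices** — the
simple-graph census (p1: `N = 8`, 12,346 graphs × 70 markings, 0 violations). -/
def LemmaBPlusSimpleUpTo (N : ℕ) : Prop :=
  ∀ {V E : Type} [Fintype V] [Fintype E] [DecidableEq E], Fintype.card V ≤ N →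
    ∀ (G : MultiGraph V E), G.IsSimple → ∀ m : Fin 4 → V, 0 ≤ G.cubeSumC011 m

/-- **Lemma B⁺ on all multigraphs with ≤ N vertices from the simple ones** (induction on the
number of edges: a loop doubles `CS`, a parallel pair splits `CS` into the class sums of the two
smaller minors `G − e'` and `G/e − e'`, both on at most as many vertices). -/
theorem LemmaBPlusUpTo_of_simple {N : ℕ} (h : LemmaBPlusSimpleUpTo N) : LemmaBPlusUpTo N := by
  intro V E _ _ _ hV G m
  suffices key : ∀ n : ℕ, ∀ (V E : Type) [Fintype V] [Fintype E] [DecidableEq E],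
      Fintype.card E = n → Fintype.card V ≤ N → ∀ (G : MultiGraph V E) (m : Fin 4 → V),
        0 ≤ G.cubeSumC011 m from key _ V E rfl hV G m
  intro n
  induction n using Nat.strong_induction_on with
  | _ n ih =>
    intro V E _ _ _ hE hV G m
    classical
    by_cases hl : ∃ e, G.fst e = G.snd e
    · -- a loop
      obtain ⟨e, he⟩ := hl
      rw [G.cubeSumC011_loop he, G.cubeSumDel_eq_minor]
      have hlt : Fintype.card (Face (fun x => decide (x ≠ e)) (⊥ : Config E)) < n := by
        rw [← hE]
        exact Fintype.card_subtype_lt (x := e) (by simp)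
      have := ih _ hlt _ _ rfl ((Fintype.card_quotient_le (G.connSetoid ⊥)).trans hV)
        (G.minor (fun x => decide (x ≠ e)) ⊥) (fun i => G.sureClass ⊥ (m i))
      linarith
    by_cases hp : ∃ e e', G.Parallel e e' ∧ e ≠ e'
    · -- a parallel pair
      obtain ⟨e, e', hpar, hne⟩ := hp
      rw [G.cubeSumC011_parallel hne hpar, G.cubeSumDel_eq_minor, G.cubeSumDelCon_eq_minor m hne]
      have hlt₁ : Fintype.card (Face (fun x => decide (x ≠ e')) (⊥ : Config E)) < n := by
        rw [← hE]
        exact Fintype.card_subtype_lt (x := e') (by simp)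
      have hlt₂ : Fintype.card (Face (fun x => decide (x ≠ e')) (fun x => decide (x = e))) < n := by
        rw [← hE]
        exact Fintype.card_subtype_lt (x := e') (by simp)
      have h₁ := ih _ hlt₁ _ _ rfl ((Fintype.card_quotient_le (G.connSetoid ⊥)).trans hV)
        (G.minor (fun x => decide (x ≠ e')) ⊥) (fun i => G.sureClass ⊥ (m i))
      have h₂ := ih _ hlt₂ _ _ rfl
        ((Fintype.card_quotient_le (G.connSetoid fun x => decide (x = e))).trans hV)
        (G.minor (fun x => decide (x ≠ e')) (fun x => decide (x = e)))
        (fun i => G.sureClass (fun x => decide (x = e)) (m i))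
      linarith
    · -- simple
      push Not at hl hp
      exact h hV G ⟨hl, hp⟩ m

/-- **C-011 on ≤ N vertices from the simple-graph census.** -/
theorem C011UpTo_of_simple {N : ℕ} (h : LemmaBPlusSimpleUpTo N) : C011UpTo N :=
  C011UpTo_of_LemmaBPlusUpTo (LemmaBPlusUpTo_of_simple h)

/-- **C-005 on ≤ N vertices from the simple-graph census.** -/
theorem C005UpTo_of_simple {N : ℕ} (h : LemmaBPlusSimpleUpTo N) : C005UpTo N :=
  C005UpTo_of_LemmaBPlusUpTo (LemmaBPlusUpTo_of_simple h)

end PercRepro
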